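import Summits.RiemannHypothesis.RiemannHypothesis.Theorems.TiltedLandingLaw421R3RateSkeleton

/-! # RATE residual, LENS-2 socket frame — the MOVING-CHILD twins (`…B`), fork of `…R3RateSkeleton` (append-only)
`…R3RateSkeleton` (v2, landed) types the far node and every one-level law with the SIMPLICITY binder `f⁽ᵏ⁺¹⁾ v ≠ 0` on the lowest state `v`.
The proved child-existence law R1a′ (`FarChildExistsLawSep`, GLUE-2A v4) delivers at a charged far level an upper critical point `w` with
`f⁽ᵏ⁾(w) ≠ 0` — a MOVING child — and says nothing about the simplicity of `v`; the multiple-lowest class is folded into the laws (director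
(CA519)(2)(b)), so the whole chain GLUE-2A → walk → one-level laws must be typed on the moving binder `iteratedDeriv k f w ≠ 0`.  A landed module is
append-only (PATCH p797826 bounced), hence this fork: §1 states the PRIMED twins `X'` of the eighteen declarations of the `FarNode` cone of
`…R3RateSkeleton` — each is the tree text with a trailing prime on the cone names and the moving binder in place of the simplicity binder (the 8 tokens
of `lens2/RateSkeletonDefs-v2-to-v3.udiff` ad1ace9d: `FarNode` l.38, `ThresholdCapLawCharged` l.171/173, `ThresholdCapLawBelow` l.181/183,
`UnchargedCreepLaw` l.193/195, `FarFieldModulusLawA` l.231); declarations of `…R3RateSkeleton` that do not mention the cone (`nested_of_jensen_far`,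
`readyR2_mono`, `not_charged_of_readyR2_all`, `lam_sq_le_record`, `riseSupQ`/`consSupQ`, `rateLawsHalfQ_of_canonical`, …) are used UNPRIMED.
§2 is the one-way BRIDGE (critic rh-split-ref-2 g25, `StrengthCert_v3_v2.lean` 9efa869b, re-homed): on every legal frame simplicity IMPLIES the moving
binder (`movingChild_of_simple`: `‖w − Re v‖ ≤ Im v ≤ Hs ≤ R/2` and `Im w > 0` force `|Re w − Re v| < R/2`, so isolation gives `w = v` — a double zero —
or `w = v̄` — wrong sign), hence `FarNode → FarNode'` and every primed law whose nodes occur only negatively IMPLIES its tree twin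
(`thresholdCapLawCharged_of_primed`, `…Below…`, `unchargedCreepLaw_of_primed`, `farFieldModulusLawA_of_primed`), while the GLUE-2A statement goes the
other way (`f1OfModulusLawA'_of`); the laws routed through `FarEntry` (mixed polarity) are re-typed, not ordered.  The converse (moving ⇒ simple) is
not a lemma.  All laws are TYPED, not proved.  Nothing here bears on the truth of RH; RH is not proved; 33346/33347 OPEN. -/

namespace RhW08.BurgersRateG3
open Complex
open scoped ComplexConjugate
open RhW08.Round1 RhW08.StSwap RhW08.Round2 RhW08.QuadW
open RhW08.SealSwap (PBot)
open RhW08.SealSwapQ RhW08.RateSplit RhW08.IsolatedTilt RhW08.FarStep RhW08.BurgersRate RhW08.PurseP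
open RhIdea6.G17.W07C7 RhIdea6.G17.W07C7.Rev6 RhIdea6.G18.W07C8.Law421BirthS RhIdea6.G19.W07C11.Seam
open RhIdea6.G20.W07C12.Frac RhIdea6.G20.W07C12.StColP RhW07.C12.FieldSplit RhIdea6.G21.W07C13.TentMax
open RhW07.C14.TwoSided RhW07.C14.Classes RhW07.C14.Lineage RhW07.C14.Booking

/-! ## §1 the PRIMED TWINS of the `FarNode` cone (moving-child binder `iteratedDeriv k f w ≠ 0`) -/
/-- moving-child twin of `FarNode` (…R3RateSkeleton l.37, kept: append-only): §0 FAR NODE; moving-child token at tree l.38. -/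
def FarNode' (η : ℝ) (f : ℂ → ℂ) (x₀ s hmax R Hs : ℝ) (B : ℕ) (k : ℕ) (v w : ℂ) : Prop :=
  FarLevelQ η f x₀ s hmax R Hs B k ∧ IsLowest StTrkDQ η f x₀ s hmax R Hs B k v ∧ iteratedDeriv k f w ≠ 0 ∧
    (∀ z : ℂ, iteratedDeriv k f z = 0 → |z.re - v.re| < R / 2 → z = v ∨ z = conj v) ∧
    iteratedDeriv (k + 1) f w = 0 ∧ 0 < w.im ∧ ‖w - (v.re : ℂ)‖ ≤ |v.im|
/-- moving-child twin of `FarEntry` (…R3RateSkeleton l.43, kept: append-only): §0 level-wise CHAIN ENTRY; text token-identical to the tree decl up to the primed names. -/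
def FarEntry' (η : ℝ) (f : ℂ → ℂ) (x₀ s hmax R Hs : ℝ) (B : ℕ) (k : ℕ) : Prop :=
  k = 0 ∨ ∀ v₀ w₀ : ℂ, ¬ FarNode' η f x₀ s hmax R Hs B (k - 1) v₀ w₀
/-- moving-child twin of `LandingExitLaw` (…R3RateSkeleton l.129, kept: append-only): T-LZ landing-exit law; text token-identical to the tree decl up to the primed names. -/
def LandingExitLaw' (c : ℝ) (m : ℕ) : Prop :=
  ∀ (η : ℝ) (f : ℂ → ℂ) (x₀ s hmax R Hs : ℝ) (B : ℕ), EngineHyps5 2 η f x₀ s hmax R Hs B →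
    ∀ (k : ℕ) (v w : ℂ), FarNode' η f x₀ s hmax R Hs B k v w → ‖farFieldAt f k v w‖ * w.im < c →
      ∀ u : ℂ, ReadyR2 η f x₀ s hmax R Hs B (k + m) u
/-- moving-child twin of `LandingExitLawAbove` (…R3RateSkeleton l.134, kept: append-only): T-LZ above threshold (the population the glue consumes); text token-identical to the tree decl up to the primed names. -/
def LandingExitLawAbove' (c : ℝ) (m : ℕ) : Prop :=
  ∀ (η : ℝ) (f : ℂ → ℂ) (x₀ s hmax R Hs : ℝ) (B : ℕ), EngineHyps5 2 η f x₀ s hmax R Hs B →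
    ∀ (k : ℕ) (v w : ℂ), FarNode' η f x₀ s hmax R Hs B k v w → η / s < ‖farFieldAt f k v w‖ → ‖farFieldAt f k v w‖ * w.im < c →
      ∀ u : ℂ, ReadyR2 η f x₀ s hmax R Hs B (k + m) u
/-- moving-child twin of `landingExitLawAbove_of` (…R3RateSkeleton l.139, kept: append-only): (K) unrestricted ⇒ above-threshold; text token-identical to the tree decl up to the primed names. -/
theorem landingExitLawAbove_of' (c : ℝ) (m : ℕ) (h : LandingExitLaw' c m) : LandingExitLawAbove' c m :=
  fun η f x₀ s hmax R Hs B hE k v w hN _ hc => h η f x₀ s hmax R Hs B hE k v w hN hc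
/-- moving-child twin of `no_charge_after_landing` (…R3RateSkeleton l.155, kept: append-only): (K) no charged level from `k+m` on after a landing; text token-identical to the tree decl up to the primed names. -/
theorem no_charge_after_landing' {c : ℝ} {m : ℕ} (hL : LandingExitLaw' c m) {η : ℝ} {f : ℂ → ℂ} {x₀ s hmax R Hs : ℝ} {B : ℕ}
    (hE : EngineHyps5 2 η f x₀ s hmax R Hs B) {k : ℕ} {v w : ℂ} (hN : FarNode' η f x₀ s hmax R Hs B k v w)
    (hc : ‖farFieldAt f k v w‖ * w.im < c) : ∀ i : ℕ, k + m ≤ i → ¬ Charged (PTrkSQ PBot) StTrkDQ ReadyR2 η f x₀ s hmax R Hs B i :=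
  fun _ hi => not_charged_of_readyR2_all fun u => readyR2_mono hi (hL η f x₀ s hmax R Hs B hE k v w hN hc u)
/-- moving-child twin of `no_charge_after_landing_above` (…R3RateSkeleton l.160, kept: append-only): (K) same, above-threshold form; text token-identical to the tree decl up to the primed names. -/
theorem no_charge_after_landing_above' {c : ℝ} {m : ℕ} (hL : LandingExitLawAbove' c m) {η : ℝ} {f : ℂ → ℂ} {x₀ s hmax R Hs : ℝ} {B : ℕ}
    (hE : EngineHyps5 2 η f x₀ s hmax R Hs B) {k : ℕ} {v w : ℂ} (hN : FarNode' η f x₀ s hmax R Hs B k v w)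
    (hthr : η / s < ‖farFieldAt f k v w‖) (hc : ‖farFieldAt f k v w‖ * w.im < c) :
    ∀ i : ℕ, k + m ≤ i → ¬ Charged (PTrkSQ PBot) StTrkDQ ReadyR2 η f x₀ s hmax R Hs B i :=
  fun _ hi => not_charged_of_readyR2_all fun u => readyR2_mono hi (hL η f x₀ s hmax R Hs B hE k v w hN hthr hc u)
/-- moving-child twin of `ThresholdCapLawCharged` (…R3RateSkeleton l.167, kept: append-only): T-CAP⁰ charged-successor threshold cap; moving-child token at tree l.171,173. -/
def ThresholdCapLawCharged' (θ : ℝ) : Prop :=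
  ∀ (η : ℝ) (f : ℂ → ℂ) (x₀ s hmax R Hs : ℝ) (B : ℕ), EngineHyps5 2 η f x₀ s hmax R Hs B →
    ∀ (j : ℕ) (v w v' w' : ℂ), FarLevelQ η f x₀ s hmax R Hs B j → FarLevelQ η f x₀ s hmax R Hs B (j + 1) →
      Charged (PTrkSQ PBot) StTrkDQ ReadyR2 η f x₀ s hmax R Hs B (j + 1) →
      IsLowest StTrkDQ η f x₀ s hmax R Hs B j v → iteratedDeriv j f w ≠ 0 →
        (∀ z : ℂ, iteratedDeriv j f z = 0 → |z.re - v.re| < R / 2 → z = v ∨ z = conj v) → iteratedDeriv (j + 1) f w = 0 → 0 < w.im → ‖w - (v.re : ℂ)‖ ≤ |v.im| →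
      IsLowest StTrkDQ η f x₀ s hmax R Hs B (j + 1) v' → iteratedDeriv (j + 1) f w' ≠ 0 →
        (∀ z : ℂ, iteratedDeriv (j + 1) f z = 0 → |z.re - v'.re| < R / 2 → z = v' ∨ z = conj v') → iteratedDeriv (j + 2) f w' = 0 → 0 < w'.im →
        ‖w' - (v'.re : ℂ)‖ ≤ |v'.im| →
      ‖farFieldAt f (j + 1) v' w'‖ ≤ max ‖farFieldAt f j v w‖ ((1 + θ) * η / s)
/-- moving-child twin of `ThresholdCapLawBelow` (…R3RateSkeleton l.178, kept: append-only): T-CAP-below: below-threshold cap through any successor; moving-child token at tree l.181,183. -/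
def ThresholdCapLawBelow' (θ : ℝ) : Prop :=
  ∀ (η : ℝ) (f : ℂ → ℂ) (x₀ s hmax R Hs : ℝ) (B : ℕ), EngineHyps5 2 η f x₀ s hmax R Hs B →
    ∀ (j : ℕ) (v w v' w' : ℂ), FarLevelQ η f x₀ s hmax R Hs B j → FarLevelQ η f x₀ s hmax R Hs B (j + 1) →
      IsLowest StTrkDQ η f x₀ s hmax R Hs B j v → iteratedDeriv j f w ≠ 0 →
        (∀ z : ℂ, iteratedDeriv j f z = 0 → |z.re - v.re| < R / 2 → z = v ∨ z = conj v) → iteratedDeriv (j + 1) f w = 0 → 0 < w.im → ‖w - (v.re : ℂ)‖ ≤ |v.im| →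
      IsLowest StTrkDQ η f x₀ s hmax R Hs B (j + 1) v' → iteratedDeriv (j + 1) f w' ≠ 0 →
        (∀ z : ℂ, iteratedDeriv (j + 1) f z = 0 → |z.re - v'.re| < R / 2 → z = v' ∨ z = conj v') → iteratedDeriv (j + 2) f w' = 0 → 0 < w'.im →
        ‖w' - (v'.re : ℂ)‖ ≤ |v'.im| →
      ‖farFieldAt f j v w‖ ≤ (1 + θ) * η / s →
      ‖farFieldAt f (j + 1) v' w'‖ ≤ (1 + θ) * η / s
/-- moving-child twin of `UnchargedCreepLaw` (…R3RateSkeleton l.189, kept: append-only): T-CREEP: uncharged creep above threshold away from the landing zone; moving-child token at tree l.193,195. -/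
def UnchargedCreepLaw' (θu : ℝ) : Prop :=
  ∀ (η : ℝ) (f : ℂ → ℂ) (x₀ s hmax R Hs : ℝ) (B : ℕ), EngineHyps5 2 η f x₀ s hmax R Hs B →
    ∀ (j : ℕ) (v w v' w' : ℂ), FarLevelQ η f x₀ s hmax R Hs B j → FarLevelQ η f x₀ s hmax R Hs B (j + 1) →
      ¬ Charged (PTrkSQ PBot) StTrkDQ ReadyR2 η f x₀ s hmax R Hs B (j + 1) →
      IsLowest StTrkDQ η f x₀ s hmax R Hs B j v → iteratedDeriv j f w ≠ 0 →
        (∀ z : ℂ, iteratedDeriv j f z = 0 → |z.re - v.re| < R / 2 → z = v ∨ z = conj v) → iteratedDeriv (j + 1) f w = 0 → 0 < w.im → ‖w - (v.re : ℂ)‖ ≤ |v.im| →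
      IsLowest StTrkDQ η f x₀ s hmax R Hs B (j + 1) v' → iteratedDeriv (j + 1) f w' ≠ 0 →
        (∀ z : ℂ, iteratedDeriv (j + 1) f z = 0 → |z.re - v'.re| < R / 2 → z = v' ∨ z = conj v') → iteratedDeriv (j + 2) f w' = 0 → 0 < w'.im →
        ‖w' - (v'.re : ℂ)‖ ≤ |v'.im| →
      η / s < ‖farFieldAt f j v w‖ → (5 : ℝ) / 4 ≤ ‖farFieldAt f j v w‖ * w.im →
      ‖farFieldAt f (j + 1) v' w'‖ ≤ ‖farFieldAt f j v w‖ * (1 + θu * s ^ 2 / w.im ^ 2)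
/-- moving-child twin of `FarChainEntryExitLaw` (…R3RateSkeleton l.203, kept: append-only): T-ENTRY far-chain entry/exit law; text token-identical to the tree decl up to the primed names. -/
def FarChainEntryExitLaw' (θ' : ℝ) : Prop :=
  ∀ (η : ℝ) (f : ℂ → ℂ) (x₀ s hmax R Hs : ℝ) (B : ℕ), EngineHyps5 2 η f x₀ s hmax R Hs B →
    ∀ (k : ℕ) (v w : ℂ), FarNode' η f x₀ s hmax R Hs B k v w → FarEntry' η f x₀ s hmax R Hs B k →
      (1 + θ') * η / s < ‖farFieldAt f k v w‖ →
      ∀ j : ℕ, k ≤ j → (∀ i : ℕ, k ≤ i → i ≤ j → FarLevelQ η f x₀ s hmax R Hs B i) →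
        ¬ Charged (PTrkSQ PBot) StTrkDQ ReadyR2 η f x₀ s hmax R Hs B j
/-- moving-child twin of `FarChainEntryLawCharged` (…R3RateSkeleton l.210, kept: append-only): B5 on level-wise charged entries; text token-identical to the tree decl up to the primed names. -/
def FarChainEntryLawCharged' (θ' : ℝ) : Prop :=
  ∀ (η : ℝ) (f : ℂ → ℂ) (x₀ s hmax R Hs : ℝ) (B : ℕ), EngineHyps5 2 η f x₀ s hmax R Hs B →
    ∀ (k : ℕ) (v w : ℂ), FarNode' η f x₀ s hmax R Hs B k v w → FarEntry' η f x₀ s hmax R Hs B k →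
      Charged (PTrkSQ PBot) StTrkDQ ReadyR2 η f x₀ s hmax R Hs B k → ‖farFieldAt f k v w‖ ≤ (1 + θ') * η / s
/-- moving-child twin of `farChainEntryLawCharged_of_exit` (…R3RateSkeleton l.215, kept: append-only): (K) the charged-entry bound is the `j = k` instance; text token-identical to the tree decl up to the primed names. -/
theorem farChainEntryLawCharged_of_exit' (θ' : ℝ) (h : FarChainEntryExitLaw' θ') : FarChainEntryLawCharged' θ' := by
  intro η f x₀ s hmax R Hs B hE k v w hN hent hch
  by_contra hlt
  push Not at hlt
  have hfar : ∀ i : ℕ, k ≤ i → i ≤ k → FarLevelQ η f x₀ s hmax R Hs B i := by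
    intro i hki hik
    obtain rfl : i = k := le_antisymm hik hki
    exact hN.1
  exact h η f x₀ s hmax R Hs B hE k v w hN hent hlt k le_rfl hfar hch
/-- moving-child twin of `FarFieldModulusLawA` (…R3RateSkeleton l.228, kept: append-only): T-MOD far-field modulus law on the axis-centred Jensen disc; moving-child token at tree l.231. -/
def FarFieldModulusLawA' (lam : ℝ) : Prop :=
  ∀ (η : ℝ) (f : ℂ → ℂ) (x₀ s hmax R Hs : ℝ) (B : ℕ), EngineHyps5 2 η f x₀ s hmax R Hs B →
    ∀ (j : ℕ) (v w : ℂ), FarLevelQ η f x₀ s hmax R Hs B j → Charged (PTrkSQ PBot) StTrkDQ ReadyR2 η f x₀ s hmax R Hs B j →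
      IsLowest StTrkDQ η f x₀ s hmax R Hs B j v → iteratedDeriv j f w ≠ 0 →
        (∀ z : ℂ, iteratedDeriv j f z = 0 → |z.re - v.re| < R / 2 → z = v ∨ z = conj v) → iteratedDeriv (j + 1) f w = 0 → 0 < w.im →
        ‖w - (v.re : ℂ)‖ ≤ |v.im| →
      ‖farFieldAt f j v w‖ ≤ lam * η / s
/-- moving-child twin of `F1OfModulusLawA` (…R3RateSkeleton l.238, kept: append-only): GLUE-2A statement: modulus law (`λ² ≤ 5/4`) ⇒ F1(4/5); text token-identical to the tree decl up to the primed names. -/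
def F1OfModulusLawA' : Prop :=
  ∀ lam : ℝ, 0 < lam → lam ^ 2 ≤ 5 / 4 → FarFieldModulusLawA' lam → FarEnergyLawCQ (4 / 5)
/-- moving-child twin of `ModulusOfLawsG3A` (…R3RateSkeleton l.245, kept: append-only): GLUE-G3A statement: the five laws ⇒ the modulus law at `λ = (1+θ)(1+θ′)e^{2θu}`; text token-identical to the tree decl up to the primed names. -/
def ModulusOfLawsG3A' : Prop :=
  ∀ θ θu θ' : ℝ, 0 ≤ θ → 0 ≤ θu → 0 ≤ θ' → ((1 + θ) * (1 + θ') * Real.exp (2 * θu)) ^ 2 ≤ 5 / 4 →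
    LandingExitLawAbove' (5 / 4) 2 → ThresholdCapLawCharged' θ → ThresholdCapLawBelow' θ → UnchargedCreepLaw' θu → FarChainEntryExitLaw' θ' →
    FarFieldModulusLawA' ((1 + θ) * (1 + θ') * Real.exp (2 * θu))
/-- moving-child twin of `farEnergyLawCQ_of_laws` (…R3RateSkeleton l.261, kept: append-only): F1 assembly at the constants of record (real proof); text token-identical to the tree decl up to the primed names. -/
theorem farEnergyLawCQ_of_laws' (hG : ModulusOfLawsG3A') (hF : F1OfModulusLawA') (hL : LandingExitLawAbove' (5 / 4) 2)
    (hC : ThresholdCapLawCharged' (1 / 200)) (hB : ThresholdCapLawBelow' (1 / 200)) (hU : UnchargedCreepLaw' (3 / 100))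
    (hE : FarChainEntryExitLaw' (1 / 25)) : FarEnergyLawCQ (4 / 5) := by
  have hsq := lam_sq_le_record
  have hlam : (0 : ℝ) < (1 + 1 / 200) * (1 + 1 / 25) * Real.exp (2 * (3 / 100)) := by positivity
  exact hF _ hlam hsq (hG _ _ _ (by norm_num) (by norm_num) (by norm_num) hsq hL hC hB hU hE)
/-- moving-child twin of `rateLawsHalfQ_of_laws` (…R3RateSkeleton l.389, kept: append-only): (K) on to `RateLawsHalfQ` with the canonical non-far budgets; text token-identical to the tree decl up to the primed names. -/
theorem rateLawsHalfQ_of_laws' (hG : ModulusOfLawsG3A') (hF : F1OfModulusLawA') (hL : LandingExitLawAbove' (5 / 4) 2)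
    (hCap : ThresholdCapLawCharged' (1 / 200)) (hB : ThresholdCapLawBelow' (1 / 200)) (hU : UnchargedCreepLaw' (3 / 100))
    (hE : FarChainEntryExitLaw' (1 / 25)) (hN : CanonicalNonFarQ) : RhW08.RateSplit.RateLawsHalfQ :=
  rateLawsHalfQ_of_canonical (farEnergyLawCQ_of_laws' hG hF hL hCap hB hU hE) hN.1 hN.2.1 hN.2.2

/-! ## §2 the BRIDGE simple ⇒ moving (critic g25 `StrengthCert_v3_v2.lean` 9efa869b, re-homed) -/
/-- Pointwise bridge: on a legal frame (`2·Hs ≤ R`, `0 < Im v ≤ Hs`), simplicity of `v` + `R/2`-isolation + a child `w` of `f⁽ᵏ⁺¹⁾` in the closed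
axis-centred Jensen disc with `Im w > 0` ⇒ the moving binder `f⁽ᵏ⁾ w ≠ 0` (else `|Re w − Re v| < R/2` makes `w = v`, a double zero, or `w = v̄`). -/
theorem movingChild_of_simple {f : ℂ → ℂ} {k : ℕ} {v w : ℂ} {R Hs : ℝ}
    (hs : iteratedDeriv (k + 1) f v ≠ 0)
    (hiso : ∀ z : ℂ, iteratedDeriv k f z = 0 → |z.re - v.re| < R / 2 → z = v ∨ z = conj v)
    (hw : iteratedDeriv (k + 1) f w = 0) (hwim : 0 < w.im) (hd : ‖w - (v.re : ℂ)‖ ≤ |v.im|)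
    (hv0 : 0 < v.im) (hvHs : v.im ≤ Hs) (hHsR : 2 * Hs ≤ R) : iteratedDeriv k f w ≠ 0 := by
  intro h0
  have hn : ‖w - (v.re : ℂ)‖ ^ 2 = (w.re - v.re) ^ 2 + w.im ^ 2 := by
    rw [← Complex.normSq_eq_norm_sq, Complex.normSq_apply, Complex.sub_re, Complex.sub_im, Complex.ofReal_re, Complex.ofReal_im, sub_zero]
    ring
  have h1 : (w.re - v.re) ^ 2 + w.im ^ 2 ≤ v.im ^ 2 := by
    rw [← hn, ← sq_abs v.im]; exact pow_le_pow_left₀ (norm_nonneg _) hd 2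
  have h2 : (w.re - v.re) ^ 2 < (R / 2) ^ 2 := by nlinarith [hwim, hv0, hvHs, hHsR]
  have hre : |w.re - v.re| < R / 2 := abs_lt_of_sq_lt_sq h2 (by linarith)
  rcases hiso w h0 hre with h | h
  · exact hs (h ▸ hw)
  · rw [h, Complex.conj_im] at hwim; linarith
/-- (K) conjunct 10 of `EngineHyps5 2`: the zero strip fits the window, `2·Hs ≤ R`. -/
theorem two_Hs_le_R {η : ℝ} {f : ℂ → ℂ} {x₀ s hmax R Hs : ℝ} {B : ℕ} (hE : EngineHyps5 2 η f x₀ s hmax R Hs B) : 2 * Hs ≤ R := by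
  obtain ⟨-, -, -, -, -, -, -, -, -, h, -⟩ := hE; exact h
/-- FAR NODE bridge: the tree's (simple) far node is a primed (moving-child) far node on every legal frame. -/
theorem farNode'_of_farNode {η : ℝ} {f : ℂ → ℂ} {x₀ s hmax R Hs : ℝ} {B : ℕ} (hE : EngineHyps5 2 η f x₀ s hmax R Hs B) {k : ℕ} {v w : ℂ}
    (h : FarNode η f x₀ s hmax R Hs B k v w) : FarNode' η f x₀ s hmax R Hs B k v w := by
  obtain ⟨hF, hL, hs, hiso, hw, hwim, hd⟩ := h
  exact ⟨hF, hL, movingChild_of_simple hs hiso hw hwim hd hL.1.2.2.1 hL.1.2.2.2.2 (two_Hs_le_R hE), hiso, hw, hwim, hd⟩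
/-- T-CAP⁰ bridge: the primed law implies the tree law. -/
theorem thresholdCapLawCharged_of_primed (θ : ℝ) (h3 : ThresholdCapLawCharged' θ) : ThresholdCapLawCharged θ := by
  intro η f x₀ s hmax R Hs B hE j v w v' w' hF hF' hCh hL hs hiso hw hwim hd hL' hs' hiso' hw' hwim' hd'
  have hR := two_Hs_le_R hE
  exact h3 η f x₀ s hmax R Hs B hE j v w v' w' hF hF' hCh hL (movingChild_of_simple hs hiso hw hwim hd hL.1.2.2.1 hL.1.2.2.2.2 hR)
    hiso hw hwim hd hL' (movingChild_of_simple hs' hiso' hw' hwim' hd' hL'.1.2.2.1 hL'.1.2.2.2.2 hR) hiso' hw' hwim' hd'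
/-- T-CAP-below bridge: the primed law implies the tree law. -/
theorem thresholdCapLawBelow_of_primed (θ : ℝ) (h3 : ThresholdCapLawBelow' θ) : ThresholdCapLawBelow θ := by
  intro η f x₀ s hmax R Hs B hE j v w v' w' hF hF' hL hs hiso hw hwim hd hL' hs' hiso' hw' hwim' hd' hle
  have hR := two_Hs_le_R hE
  exact h3 η f x₀ s hmax R Hs B hE j v w v' w' hF hF' hL (movingChild_of_simple hs hiso hw hwim hd hL.1.2.2.1 hL.1.2.2.2.2 hR)
    hiso hw hwim hd hL' (movingChild_of_simple hs' hiso' hw' hwim' hd' hL'.1.2.2.1 hL'.1.2.2.2.2 hR) hiso' hw' hwim' hd' hle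
/-- T-CREEP bridge: the primed law implies the tree law. -/
theorem unchargedCreepLaw_of_primed (θu : ℝ) (h3 : UnchargedCreepLaw' θu) : UnchargedCreepLaw θu := by
  intro η f x₀ s hmax R Hs B hE j v w v' w' hF hF' hnCh hL hs hiso hw hwim hd hL' hs' hiso' hw' hwim' hd' hthr hfar
  have hR := two_Hs_le_R hE
  exact h3 η f x₀ s hmax R Hs B hE j v w v' w' hF hF' hnCh hL (movingChild_of_simple hs hiso hw hwim hd hL.1.2.2.1 hL.1.2.2.2.2 hR)
    hiso hw hwim hd hL' (movingChild_of_simple hs' hiso' hw' hwim' hd' hL'.1.2.2.1 hL'.1.2.2.2.2 hR) hiso' hw' hwim' hd' hthr hfar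
/-- T-MOD bridge: the primed modulus law implies the tree modulus law. -/
theorem farFieldModulusLawA_of_primed (lam : ℝ) (h3 : FarFieldModulusLawA' lam) : FarFieldModulusLawA lam := by
  intro η f x₀ s hmax R Hs B hE j v w hF hCh hL hs hiso hw hwim hd
  exact h3 η f x₀ s hmax R Hs B hE j v w hF hCh hL (movingChild_of_simple hs hiso hw hwim hd hL.1.2.2.1 hL.1.2.2.2.2 (two_Hs_le_R hE)) hiso hw hwim hd
/-- GLUE-2A bridge (opposite direction: the modulus law is consumed): the tree statement implies the primed one. -/
theorem f1OfModulusLawA'_of (h : F1OfModulusLawA) : F1OfModulusLawA' :=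
  fun lam h0 hsq hM => h lam h0 hsq (farFieldModulusLawA_of_primed lam hM)
/-- ENTRY bridge (opposite direction: the node is negated): a primed entry level is a tree entry level. -/
theorem farEntry_of_farEntry' {η : ℝ} {f : ℂ → ℂ} {x₀ s hmax R Hs : ℝ} {B : ℕ} (hE : EngineHyps5 2 η f x₀ s hmax R Hs B) {k : ℕ}
    (h : FarEntry' η f x₀ s hmax R Hs B k) : FarEntry η f x₀ s hmax R Hs B k :=
  h.imp_right fun h' v₀ w₀ hN => h' v₀ w₀ (farNode'_of_farNode hE hN)

end RhW08.BurgersRateG3
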